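import Summits.ABC.IUTFork.Repair.CandMochizuki7Ram
import HarnessLib

/-!
# IUT REPAIR BRANCH (rung LADDER-ABC:A2.RP) — row RP-M47 (c) `FullInd` on the RAMIFIED SHEAR bed: FALSE (print's (Ind2) is product-structured)

Record file (D-0012; one MODEL-DATA definition `shear` — a packet transvection —, then proofs; no `Prop` fact; nothing asserted about print) of the
abc-iut cell, seat abc-iut-rp-m1 (gen 3; class (ii)). TAKES NO SIDE on [IUTchIII] Cor. 3.12 or on any author; candidates are hypotheses; typed ≠
proved. Sequel to `Repair/CandMochizuki7Ram` (cells (a), (b) of RP-M47 and the M01/M45 rows on RAM(p, m)).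

ROW RP-M47 (c) (`CandMochizuki7.FullInd` / `H''`, this seat's gen 2): «the (Ind2)-indeterminacy acting on the tensor packets is the FULL group of
automorphisms preserving the mono-analytic integral structures `I(^{S±}_{j+1};D⊢_{v_ℚ})` of Thm. 3.11 (i)(a)» — a PARAPHRASE-by-extrapolation of
[Rpt2018] (VUC3) p. 14 l. 11–32 / (†ΘCR) p. 16 l. 58–66 «not the rigidified G ↷ O×μ», from the log-shell to the packets. On the beds of record the
packets are LINES and (c) holds exactly where every ball-isometry of the line is a unit multiple (`CandMochizuki7.fullInd_uSetting`) and fails at the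
sign-rigidified CM (`not_fullInd_CM`). On the ramified bed the packets have rank `2^{j+1}` and the integral structure is the lattice `𝕀_j = ⊗^{j+1} I`
(`RamifiedWitness.ramData`): its stabiliser is `GL(𝕀_j) ≅ GL_{2^{j+1}}(ℤ_(p))`, STRICTLY larger than the factorwise products `⊗_i GL(I)` that (Ind2)
consists of ([IUTchIII] Thm. 3.11 (i) (Ind2), p. 154: «independent copies of Ism on each of the direct summands of the j+1 factors»). KERNEL:
* `shear` — the transvection `x ↦ x + x_{π…π}·e_{1…1}` of the packet at label `j` (`j ≥ 1`): maps `𝕀_j` onto itself (`image_shear_integral`);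
* `shear_not_kronecker` — at label `1` it is NO Kronecker product `g_0 ⊗ g_1` (its matrix has `(e_{11},e_{11}) = (e_{11},e_{ππ}) = 1` but
  `(e_{11},e_{π1}) = 0`), hence the family `shearFam ∉ (Ind2)`;
* **`not_fullInd_ram`: RP-M47 (c) FAILS at RAM(p, m)** for every `m` (and `not_H''_ram`).
READING (neutral): cells (a)/(b) «Ism not rigidified» HOLD at RAM with teeth (part V), cell (c) FAILS — as at the CM, but now for the structural
reason print gives: (Ind2) is a PRODUCT of per-factor groups, never the full stabiliser of the packet lattice in rank ≥ 2. No verdict on print.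
[claim: Mochizuki2019Report, status: disputed]
-/

noncomputable section

open Set

namespace Summit.ABC.IUTFork.Repair.CandMochizuki7Ram

open Thm311 Cor312 Cor312.Checks Cor312.IdentifiedNonVacuity Cor312Vol Cor312Vol.NaiveWitness Cor312Vol.PinnedWitness
  Cor312Vol.RamifiedWitness Literature.IUT.LogThetaLattice

variable (p : ℕ) [hp : Fact p.Prime]

/-! ## 1. The matrix of a factorwise automorphism is the Kronecker product -/

omit hp in
/-- **Matrix of an (Ind2)-shaped automorphism in the tensor basis = KRONECKER PRODUCT**: `(⊗_i g_i)(e_{ε'})_ε = Π_i (g_i)_{ε(i) ε'(i)}`. [folklore] -/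
theorem coord_factorwise_tb (j : toyIndex.Label) (vQ : toyIndex.VQ)
    (g : toyIndex.Caps j → ∀ v : toyIndex.Fibre vQ, (Fin 2 → ℚ) ≃ₗ[ℚ] (Fin 2 → ℚ)) (ε ε' : toyIndex.Caps j → Fin 2) :
    coord p j vQ ((ramShells p).factorwise j vQ (fun i => (ramShells p).summandwise vQ (g i)) (tb p j vQ ε')) ε =
      ∏ i, ent (g i (fib vQ)) (ε i) (ε' i) := by
  rw [tb_apply]
  unfold LogShells.factorwise
  erw [PiTensorProduct.congr_tprod, coord_tprod]
  refine Finset.prod_congr rfl fun i _ => ?_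
  show (g i (fib vQ) (b1 p vQ (ε' i) (fib vQ))) (ε i) = _
  rw [b1_apply]
  rfl

/-! ## 2. The packet transvection `x ↦ x + x_{π…π}·e_{1…1}` -/

/-- The nilpotent part `x ↦ x_{π…π}·e_{1…1}`. [folklore] -/
def shearNil (j : toyIndex.Label) (vQ : toyIndex.VQ) : (ramShells p).Packet j vQ →ₗ[ℚ] (ramShells p).Packet j vQ :=
  (LinearMap.toSpanSingleton ℚ _ (tb p j vQ (zeros j))) ∘ₗ coordL p j vQ (ones j)

omit hp in
/-- `shearNil x = x_{π…π}·e_{1…1}`. [folklore] -/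
@[simp] theorem shearNil_apply (j : toyIndex.Label) (vQ : toyIndex.VQ) (x : (ramShells p).Packet j vQ) :
    shearNil p j vQ x = coord p j vQ x (ones j) • tb p j vQ (zeros j) := rfl

omit hp in
/-- `(π,…,π) ≠ (1,…,1)`. [folklore] -/
theorem ones_ne_zeros (j : toyIndex.Label) : ones j ≠ zeros j := fun h => by
  have := congrFun h 0
  simp [ones, zeros] at this

omit hp in
/-- `shearNil ∘ shearNil = 0` (the coordinate `(e_{1…1})_{π…π}` vanishes). [folklore] -/
theorem shearNil_shearNil (j : toyIndex.Label) (vQ : toyIndex.VQ) (x : (ramShells p).Packet j vQ) :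
    shearNil p j vQ (shearNil p j vQ x) = 0 := by
  rw [shearNil_apply, shearNil_apply, coord_smul, coord_tb, if_neg (ones_ne_zeros j).symm, mul_zero, zero_smul]

/-- **The TRANSVECTION `shear`**: `x ↦ x + x_{π…π}·e_{1…1}`, inverse `x ↦ x − x_{π…π}·e_{1…1}` — a lattice automorphism of the packet that
mixes two tensor factors at once. [claim: Mochizuki2012, status: disputed] -/
def shear (j : toyIndex.Label) (vQ : toyIndex.VQ) : (ramShells p).Packet j vQ ≃ₗ[ℚ] (ramShells p).Packet j vQ :=
  LinearEquiv.ofLinear (LinearMap.id + shearNil p j vQ) (LinearMap.id - shearNil p j vQ)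
    (by
      ext x
      simp only [LinearMap.comp_apply, LinearMap.add_apply, LinearMap.sub_apply, LinearMap.id_apply, map_sub, shearNil_shearNil]
      abel)
    (by
      ext x
      simp only [LinearMap.comp_apply, LinearMap.add_apply, LinearMap.sub_apply, LinearMap.id_apply, map_add, shearNil_shearNil]
      abel)

omit hp in
/-- `shear x = x + x_{π…π}·e_{1…1}`. [folklore] -/
theorem shear_apply (j : toyIndex.Label) (vQ : toyIndex.VQ) (x : (ramShells p).Packet j vQ) :
    shear p j vQ x = x + coord p j vQ x (ones j) • tb p j vQ (zeros j) := rfl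

omit hp in
/-- `shear⁻¹ x = x − x_{π…π}·e_{1…1}`. [folklore] -/
theorem shear_symm_apply (j : toyIndex.Label) (vQ : toyIndex.VQ) (x : (ramShells p).Packet j vQ) :
    (shear p j vQ).symm x = x - coord p j vQ x (ones j) • tb p j vQ (zeros j) := rfl

omit hp in
/-- The matrix entries of `shear` in the row `e_{1…1}`: `shear(e_{ε'})_{1…1} = [ε' = (1,…,1)] + [ε' = (π,…,π)]`. [folklore] -/
theorem coord_shear_tb_zeros (j : toyIndex.Label) (vQ : toyIndex.VQ) (ε' : toyIndex.Caps j → Fin 2) :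
    coord p j vQ (shear p j vQ (tb p j vQ ε')) (zeros j) = (if ε' = zeros j then 1 else 0) + (if ε' = ones j then 1 else 0) := by
  rw [shear_apply, coord_add, coord_smul, coord_tb, coord_tb, coord_tb, if_pos rfl, mul_one]

/-- `shear` maps integral vectors to integral vectors … [folklore] -/
theorem integral_shear {j : toyIndex.Label} {vQ : toyIndex.VQ} {x : (ramShells p).Packet j vQ} (hx : Integral p j vQ x) :
    Integral p j vQ (shear p j vQ x) := fun ε => by
  rw [shear_apply, coord_add, coord_smul]
  exact (hx ε).add (IsPInt.mul' (hx (ones j)) (integral_tb j vQ (zeros j) ε))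

/-- … and so does its inverse. [folklore] -/
theorem integral_shear_symm {j : toyIndex.Label} {vQ : toyIndex.VQ} {x : (ramShells p).Packet j vQ} (hx : Integral p j vQ x) :
    Integral p j vQ ((shear p j vQ).symm x) := fun ε => by
  rw [shear_symm_apply, sub_eq_add_neg, ← neg_smul, coord_add, coord_smul]
  exact (hx ε).add (IsPInt.mul' (hx (ones j)).neg (integral_tb j vQ (zeros j) ε))

/-- **`shear` maps the packet log-shell lattice `𝕀_j` ONTO itself.** [folklore] -/
theorem image_shear_integral (j : toyIndex.Label) (vQ : toyIndex.VQ) :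
    shear p j vQ '' {x | Integral p j vQ x} = {x | Integral p j vQ x} := by
  apply Set.Subset.antisymm
  · rintro _ ⟨x, hx, rfl⟩; exact integral_shear p hx
  · intro y hy; exact ⟨(shear p j vQ).symm y, integral_shear_symm p hy, (shear p j vQ).apply_symm_apply y⟩

/-- The SHEAR FAMILY: the transvection on every packet. [claim: Mochizuki2012, status: disputed] -/
def shearFam : (ramShells p).PacketAut := fun j vQ => shear p j vQ

/-! ## 3. The transvection is no Kronecker product: `shearFam ∉ (Ind2)` -/

omit hp in
/-- **At label `1` the transvection is NOT of (Ind2)-shape** `⊗_i g_i`: a Kronecker product `M = g_0 ⊗ g_1` with `M_{(1,1),(1,1)} = 1` and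
`M_{(1,1),(π,π)} = 1` has `(g_0)_{11}, (g_1)_{1π} ≠ 0`, hence `M_{(1,1),(π,1)} = (g_0)_{11}(g_1)_{1π}`… — but for `shear` the entry `(e_{11}, e_{π1})` is `0`.
[folklore] -/
theorem shear_not_kronecker (vQ : toyIndex.VQ)
    (g : toyIndex.Caps 1 → ∀ v : toyIndex.Fibre vQ, (Fin 2 → ℚ) ≃ₗ[ℚ] (Fin 2 → ℚ)) :
    shear p 1 vQ ≠ (ramShells p).factorwise 1 vQ fun i => (ramShells p).summandwise vQ (g i) := fun h => by
  have ha := coord_shear_tb_zeros p 1 vQ (zeros 1)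
  have hb := coord_shear_tb_zeros p 1 vQ (ones 1)
  have hc := coord_shear_tb_zeros p 1 vQ (one0 1)
  rw [if_pos rfl, if_neg (ones_ne_zeros 1).symm, add_zero, h, coord_factorwise_tb] at ha
  rw [if_neg (ones_ne_zeros 1), if_pos rfl, zero_add, h, coord_factorwise_tb] at hb
  have h10 : one0 (1 : toyIndex.Label) ≠ zeros 1 := fun h' => by have := congrFun h' 0; simp [one0, zeros] at this
  have h11 : one0 (1 : toyIndex.Label) ≠ ones 1 := fun h' => by
    have h1 := congrFun h' 1
    have hl : toyIndex.lstar = 2 := rfl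
    simp [one0, ones] at h1
    omega
  rw [if_neg h10, if_neg h11, add_zero, h, coord_factorwise_tb, Finset.prod_eq_zero_iff] at hc
  obtain ⟨i, -, hi⟩ := hc
  have ha' := Finset.prod_ne_zero_iff.1 (by rw [ha]; exact one_ne_zero) i (Finset.mem_univ _)
  have hb' := Finset.prod_ne_zero_iff.1 (by rw [hb]; exact one_ne_zero) i (Finset.mem_univ _)
  by_cases h0 : i = 0
  · subst h0
    exact hb' (by simpa [one0, zeros, ones] using hi)
  · exact ha' (by simpa [one0, zeros, h0] using hi)

omit hp in
/-- **The shear family is NOT an (Ind2)-family** of the ramified shells. [folklore] -/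
theorem shearFam_not_mem_Ind2Family : shearFam p ∉ (ramShells p).Ind2Family := fun h => by
  obtain ⟨g, -, hΦ⟩ := h 1 ()
  exact shear_not_kronecker p () g hΦ

/-! ## 4. RP-M47 (c) FAILS at RAM(p, m) -/

variable (m : ℕ)

/-- **RP-M47 (c) `CandMochizuki7.FullInd` FAILS at RAM(p, m)**: the shear family maps every integral structure `𝕀_j` onto itself and is no
(Ind2)-family — the full stabiliser of the packet lattice is strictly larger than print's product-structured (Ind2).
[claim: Mochizuki2019Report, status: disputed] -/
theorem not_fullInd_ram : ¬ CandMochizuki7.FullInd (ramLattice p m) (ramSettingL p m) := fun h =>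
  shearFam_not_mem_Ind2Family p (h (shearFam p) fun j vQ => image_shear_integral p j vQ)

/-- RP-M47 (c) cell, candidate form: `¬ H''` at RAM(p, m) for every region reading and q-datum. [claim: Mochizuki2019Report, status: disputed] -/
theorem not_H''_ram (ρ : (∀ v : toyIndex.V, v ∈ toyIndex.Vbad → Set ((ramShells p).StarPacket v)) →
      ∀ (j : toyIndex.Label) (vQ : toyIndex.VQ), Set ((ramShells p).Packet j vQ))
    (qK : ∀ v : toyIndex.V, v ∈ toyIndex.Vbad → Set ((ramShells p).StarPacket v)) :
    ¬ CandMochizuki7.H'' (ramLattice p m) (ramSettingL p m) ρ qK :=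
  not_fullInd_ram p m

/-- **RP-M47 on RAM(p, m), all three cells**: (a) ✓, (b) ✓, (c) ✗ — with strict indeterminacy-borne hull inflation (part V `M47_ram`).
[claim: Mochizuki2019Report, status: disputed] -/
theorem M47_ram_cells (ρ : (∀ v : toyIndex.V, v ∈ toyIndex.Vbad → Set ((ramShells p).StarPacket v)) →
      ∀ (j : toyIndex.Label) (vQ : toyIndex.VQ), Set ((ramShells p).Packet j vQ))
    (qK : ∀ v : toyIndex.V, v ∈ toyIndex.Vbad → Set ((ramShells p).StarPacket v)) :
    CandMochizuki7.H (ramLattice p m) (ramSettingL p m) ρ qK ∧ CandMochizuki7.H' (ramLattice p m) (ramSettingL p m) ρ qK ∧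
      ¬ CandMochizuki7.H'' (ramLattice p m) (ramSettingL p m) ρ qK :=
  ⟨(M47_ram p m ρ qK).1, (M47_ram p m ρ qK).2.1, not_H''_ram p m ρ qK⟩

end Summit.ABC.IUTFork.Repair.CandMochizuki7Ram

end
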